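import Summits.CriticalPhenomena.PercolationContinuityZ3.Theorems.PercNearOneGluingNoHeavyPcintChordDefs
import Literature.Probability.Percolation.RussoFormula
import Literature.Probability.Percolation.PercolationProofs
import Mathlib.Combinatorics.SimpleGraph.Metric
import HarnessLib

/-!
# PCINT lane, reduction B3: `θ(p) ≤ Σ_{|γ|=n} pⁿ (1-p)^{#chords(γ)}` (a shortest open path has all its lattice chords closed)

Cell `prim-pcint` (PAPER-2 track (iii): certified intervals for `p_c(ℤ^d)`), seat `prim-pcint-2`;
memo `run/shared/lean/prim/pcint/REDUCTIONS.md` §R1, §B3.  Does NOT build on p205010.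

Grimmett's path counting (Percolation 1999, §1.4 (1.15)–(1.16); the tree's
`theta_le_card_sawWords_mul_pow`) bounds `θ(p)` by the expected number of open self-avoiding paths
of length `n` from the origin, `σ(n) pⁿ`.  Here the necessary condition is sharpened: if the open
cluster of `0` is infinite then for every `n` there is an open path of length `n` from `0` which is a
SHORTEST open path to its endpoint (a geodesic of the open subgraph); a geodesic has all its lattice
CHORDS (lattice edges joining two of its vertices that are not consecutive on it) CLOSED, since an open
chord would shortcut it.  The path edges and the chords are disjoint edge sets, so the open-path /
closed-chords cylinder has probability `pⁿ (1-p)^{#chords}` and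

  `θ(p) ≤ Σ_{w ∈ sawWords d n} pⁿ (1 - p)^{(chordEdges w).card}`       (`theta_le_sum_sawWords_chordWeight`).

This is the reduction behind certificate kind `chord_cw` (B3) of the lane: a finite-memory walk
automaton with weights `p (1-p)^{#window chords}` and a Collatz–Wielandt vector turns it into
certified lower bounds on `p_c^bond(ℤ^d)` (REDUCTIONS.md §R2; canary d = 3, k = 12: p_c ≥ 0.2188,
above the printed 1/4.7387 = 0.2110).

Main results (namespace `Summit.CriticalPhenomena.PercolationContinuityZ3.Theorems.Pcint`):
* `Walk.not_adj_getVert_of_isGeodesic` — a distance-realising walk has no chord (any simple graph);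
* (definitions `chordEdges` etc. in `…PcintChordDefs.lean`);
* `exists_geodesicWord_of_percolatesAt` — percolation ⇒ for every `n` an open SAW word of length `n`
  with all chord edges closed;
* `bondPercolation_real_open_closed` — `P_p(F₁ open, F₂ closed) = p^{|F₁|} (1-p)^{|F₂|}`;
* `theta_le_sum_sawWords_chordWeight` — the displayed bound;
* `theta_zd_eq_zero_of_chordWeight_le_geometric`, `le_criticalProb_zd_of_chordWeight_le_geometric` —
  the glue consumed by certificate files (geometric domination of the weighted counts ⇒ `p ≤ p_c`).
-/

noncomputable section

namespace Summit.CriticalPhenomena.PercolationContinuityZ3.Theorems.Pcint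

open MeasureTheory Literature.Probability.Percolation Literature.Probability.LatticeModels

/-! ### A distance-realising walk has no chord -/

/-- In any simple graph, a walk whose length equals the graph distance between its endpoints has no
chord: no two of its vertices at positions `i` and `j ≥ i + 2` are adjacent (an edge between them
would give a strictly shorter walk). [folklore] -/
theorem Walk.not_adj_getVert_of_isGeodesic {V : Type*} {H : SimpleGraph V} {u v : V}
    (r : H.Walk u v) (hr : r.length = H.dist u v) {i j : ℕ} (hij : i + 2 ≤ j) (hj : j ≤ r.length) :
    ¬ H.Adj (r.getVert i) (r.getVert j) := by
  intro h
  set W : H.Walk u v := (r.take i).append (SimpleGraph.Walk.cons h (r.drop j)) with hW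
  have hlen : W.length = min i r.length + 1 + (r.length - j) := by
    rw [hW, SimpleGraph.Walk.length_append, SimpleGraph.Walk.length_cons,
      SimpleGraph.Walk.take_length, SimpleGraph.Walk.drop_length]
    omega
  have hle := SimpleGraph.dist_le W
  rw [hlen, ← hr, Nat.min_eq_left (by omega : i ≤ r.length)] at hle
  omega

variable {d : ℕ}

/-! ### Percolation forces open geodesic words with closed chords -/

/-- **A shortest open path has closed chords.** If `C(0)` is infinite (and `ω ⊆ E(𝕃^d)`), then for
every `n` some self-avoiding word of length `n` has all its edges open AND all its chord edges
closed: take a site `y` of the cluster not reachable by fewer than `n` steps, a SHORTEST open path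
to it (Mathlib `Reachable.exists_path_of_dist`), and its first `n` steps; an open chord between
steps `i` and `j ≥ i + 2` would shortcut the geodesic. [folklore] -/
theorem exists_geodesicWord_of_percolatesAt {ω : BondConfig (Site d)}
    (hω : ω ⊆ (zdGraph d).edgeSet) (hC : ω ∈ percolatesAt (0 : Site d)) (n : ℕ) :
    ∃ w ∈ sawWords d n, (↑(wordEdges w) : Set (Sym2 (Site d))) ⊆ ω ∧
      Disjoint (↑(chordEdges w) : Set (Sym2 (Site d))) ω := by
  classical
  have hG : openGraph ω ≤ zdGraph d := by
    intro a b hab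
    rw [openGraph_adj] at hab
    exact hω hab.1
  have hC' : (openCluster ω 0).Infinite := hC
  -- the finitely many endpoints of words shorter than `n`
  set S : Set (Site d) := ⋃ k : Fin n, Set.range fun w : Fin k → Fin d × Bool => wordPos w k
  have hS : S.Finite := Set.finite_iUnion fun _ => Set.finite_range _
  obtain ⟨y, hyC, hyS⟩ := (hC'.sdiff hS).nonempty
  obtain ⟨r, hrp, hrl⟩ := (hyC : (openGraph ω).Reachable 0 y).exists_path_of_dist
  -- `r` has length at least `n`, for otherwise `y ∈ S`
  have hn : n ≤ r.length := by
    by_contra hlt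
    push Not at hlt
    obtain ⟨w, hw⟩ := exists_word_of_walk hG r r.length le_rfl
    exact hyS (Set.mem_iUnion.2 ⟨⟨r.length, hlt⟩, w, by simpa using hw r.length le_rfl⟩)
  obtain ⟨w, hw⟩ := exists_word_of_walk hG r n hn
  refine ⟨w, ?_, ?_, ?_⟩
  · rw [mem_sawWords]
    intro i j hi hj hij
    rw [hw i hi, hw j hj] at hij
    exact hrp.getVert_injOn (by simp; omega) (by simp; omega) hij
  · intro e he
    rw [Finset.mem_coe, wordEdges, Finset.mem_image] at he
    obtain ⟨k, hk, rfl⟩ := he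
    rw [Finset.mem_range] at hk
    rw [hw k hk.le, hw (k + 1) hk]
    exact ((openGraph_adj ω _ _).1 (r.adj_getVert_succ (lt_of_lt_of_le hk hn))).1
  · rw [Set.disjoint_left]
    intro e he heω
    obtain ⟨i, j, hij, hjn, hadj, rfl⟩ := mem_chordEdges.1 (Finset.mem_coe.1 he)
    rw [hw i (by omega), hw j hjn] at hadj heω
    have hopen : (openGraph ω).Adj (r.getVert i) (r.getVert j) :=
      (openGraph_adj ω _ _).2 ⟨heω, hadj.ne⟩
    exact Walk.not_adj_getVert_of_isGeodesic r hrl hij (hjn.trans hn) hopen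

/-! ### The law of an open/closed cylinder -/

/-- **Cylinder probability**: for disjoint finite sets `F₁, F₂` of edges of `G`, the event "every
edge of `F₁` is open and every edge of `F₂` is closed" has probability `p^{|F₁|} (1-p)^{|F₂|}`
under `P_p` (product measure; Grimmett 1999, §1.3). [folklore] -/
theorem bondPercolation_real_open_closed {V : Type*} (G : SimpleGraph V) (p : unitInterval)
    {F₁ F₂ : Finset (Sym2 V)} (h₁ : (↑F₁ : Set (Sym2 V)) ⊆ G.edgeSet)
    (h₂ : (↑F₂ : Set (Sym2 V)) ⊆ G.edgeSet) (h : Disjoint F₁ F₂) :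
    (bondPercolation G p).real {ω | (↑F₁ : Set (Sym2 V)) ⊆ ω ∧ Disjoint (↑F₂ : Set (Sym2 V)) ω} =
      (p : ℝ) ^ F₁.card * (1 - p : ℝ) ^ F₂.card := by
  classical
  have hcyl : {ω : BondConfig V | (↑F₁ : Set (Sym2 V)) ⊆ ω ∧ Disjoint (↑F₂ : Set (Sym2 V)) ω} =
      localCylinder (↑(F₁ ∪ F₂) : Set (Sym2 V)) (↑F₁ : Set (Sym2 V)) := by
    ext ω
    simp only [Set.mem_setOf_eq, localCylinder, Finset.coe_union, Set.mem_union, Finset.mem_coe]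
    constructor
    · rintro ⟨hs, hd⟩ e he
      rcases he with he | he
      · exact ⟨fun _ => he, fun _ => hs (Finset.mem_coe.2 he)⟩
      · constructor
        · intro heω
          exact (Set.disjoint_left.1 hd (Finset.mem_coe.2 he) heω).elim
        · intro he1
          exact (Finset.disjoint_left.1 h he1 he).elim
    · intro hω
      refine ⟨fun e he => (hω e (Or.inl (Finset.mem_coe.1 he))).2 (Finset.mem_coe.1 he), ?_⟩
      rw [Set.disjoint_left]
      intro e he heω
      exact Finset.disjoint_left.1 h ((hω e (Or.inr (Finset.mem_coe.1 he))).1 heω)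
        (Finset.mem_coe.1 he)
  rw [hcyl, bondPercolation, Russo.setBernoulli_real_localCylinder, Finset.prod_union h]
  have e1 : ∀ e ∈ F₁, Russo.weight G.edgeSet (↑F₁ : Set (Sym2 V)) e (p : ℝ) = p := by
    intro e he
    simp [Russo.weight, he, h₁ (Finset.mem_coe.2 he)]
  have e2 : ∀ e ∈ F₂, Russo.weight G.edgeSet (↑F₁ : Set (Sym2 V)) e (p : ℝ) = 1 - p := by
    intro e he
    have hn : e ∉ F₁ := fun he1 => Finset.disjoint_left.1 h he1 he
    simp [Russo.weight, hn, h₂ (Finset.mem_coe.2 he)]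
  rw [Finset.prod_congr rfl e1, Finset.prod_congr rfl e2, Finset.prod_const, Finset.prod_const]

/-! ### The chord-weighted path-counting bound -/

/-- **Reduction B3** (`chord_cw`): `θ(p) ≤ Σ_{w ∈ sawWords d n} pⁿ (1 - p)^{#chordEdges w}` for
every `n` — Grimmett's (1.15) run with the sharper necessary condition "open shortest path, hence
closed chords". [folklore] -/
theorem theta_le_sum_sawWords_chordWeight (d n : ℕ) (p : unitInterval) :
    theta (zdGraph d) 0 p ≤
      ∑ w ∈ sawWords d n, (p : ℝ) ^ n * (1 - p : ℝ) ^ (chordEdges w).card := by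
  classical
  set μ := bondPercolation (zdGraph d) p with hμ
  set bad : Set (BondConfig (Site d)) := {ω | ¬ ω ⊆ (zdGraph d).edgeSet} with hbad
  set A : (Fin n → Fin d × Bool) → Set (BondConfig (Site d)) := fun w =>
    {ω | (↑(wordEdges w) : Set (Sym2 (Site d))) ⊆ ω ∧
      Disjoint (↑(chordEdges w) : Set (Sym2 (Site d))) ω} with hA
  set U : Set (BondConfig (Site d)) := ⋃ w ∈ sawWords d n, A w with hU
  have hsub : (percolatesAt 0 : Set (BondConfig (Site d))) ⊆ U ∪ bad := by
    intro ω hω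
    by_cases hb : ω ⊆ (zdGraph d).edgeSet
    · obtain ⟨w, hw, hwo, hwc⟩ := exists_geodesicWord_of_percolatesAt hb hω n
      refine Or.inl ?_
      rw [hU]
      exact Set.mem_biUnion (Finset.mem_coe.2 hw) ⟨hwo, hwc⟩
    · exact Or.inr hb
  have hbad0 : μ.real bad = 0 := by
    rw [measureReal_eq_zero_iff]
    have := ProbabilityTheory.setBernoulli_ae_subset (u := (zdGraph d).edgeSet) (p := p)
    rw [Filter.Eventually, mem_ae_iff, Set.compl_setOf] at this
    exact this
  calc theta (zdGraph d) 0 p = μ.real (percolatesAt 0) := rfl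
    _ ≤ μ.real (U ∪ bad) := measureReal_mono hsub
    _ ≤ μ.real U + μ.real bad := measureReal_union_le _ _
    _ = μ.real U := by rw [hbad0, add_zero]
    _ ≤ ∑ w ∈ sawWords d n, μ.real (A w) := measureReal_biUnion_finset_le _ _
    _ = ∑ w ∈ sawWords d n, (p : ℝ) ^ n * (1 - p : ℝ) ^ (chordEdges w).card := by
        refine Finset.sum_congr rfl fun w hw => ?_
        have hs : IsSAW w := mem_sawWords.1 hw
        rw [hA]
        simp only
        rw [hμ, bondPercolation_real_open_closed _ _ (wordEdges_subset_edgeSet w)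
          (chordEdges_subset_edgeSet w) (IsSAW.disjoint_wordEdges_chordEdges hs), hs.card_wordEdges]

/-! ### From a geometric bound on the chord-weighted counts to `p ≤ p_c` -/

/-- **Certificate glue (bond).** If at some `p` the chord-weighted path counts are dominated by a
geometric sequence with ratio `r < 1` — which is what a Collatz–Wielandt certificate for the
chord-weighted finite-memory automaton provides (REDUCTIONS.md §R2) — then `θ(p) = 0`.
[folklore] -/
theorem theta_zd_eq_zero_of_chordWeight_le_geometric (d : ℕ) (p : unitInterval) {C r : ℝ}
    (hr0 : 0 ≤ r) (hr : r < 1)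
    (h : ∀ n, ∑ w ∈ sawWords d n, (p : ℝ) ^ n * (1 - p : ℝ) ^ (chordEdges w).card ≤ C * r ^ n) :
    theta (zdGraph d) 0 p = 0 := by
  have ht : Filter.Tendsto (fun n : ℕ => C * r ^ n) Filter.atTop (nhds 0) := by
    simpa using (tendsto_pow_atTop_nhds_zero_of_lt_one hr0 hr).const_mul C
  exact le_antisymm (ge_of_tendsto' ht fun n => (theta_le_sum_sawWords_chordWeight d n p).trans (h n))
    measureReal_nonneg

/-- **Certificate glue (bond), threshold form**: under the same hypothesis, `p ≤ p_c^bond(ℤ^d)`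
(`θ` is non-decreasing, so `θ` vanishes on `[0, p]`). [folklore] -/
theorem le_criticalProb_zd_of_chordWeight_le_geometric (d : ℕ) (p : unitInterval) {C r : ℝ}
    (hr0 : 0 ≤ r) (hr : r < 1)
    (h : ∀ n, ∑ w ∈ sawWords d n, (p : ℝ) ^ n * (1 - p : ℝ) ^ (chordEdges w).card ≤ C * r ^ n) :
    (p : ℝ) ≤ criticalProb (zdGraph d) 0 := by
  have h0 := theta_zd_eq_zero_of_chordWeight_le_geometric d p hr0 hr h
  refine le_csInf ⟨1, Or.inr rfl⟩ ?_
  rintro q (⟨hq, hpos⟩ | hq)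
  · by_contra hlt
    push Not at hlt
    have hmono := theta_mono_holds (zdGraph d) (0 : Site d) (show (⟨q, hq⟩ : unitInterval) ≤ p from hlt.le)
    have : theta (zdGraph d) 0 ⟨q, hq⟩ ≤ 0 := hmono.trans_eq h0
    exact hpos.not_ge this
  · rw [Set.mem_singleton_iff] at hq
    rw [hq]
    exact p.2.2

end Summit.CriticalPhenomena.PercolationContinuityZ3.Theorems.Pcint
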